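import Mathlib
import Summits.AtomisticToContinuum.FouriersLaw.Theorems.EmbeddedDrudeMourreMourreDissolutionSlabFibre
import HarnessLib

/-!
# Slab non-concentration, region T₁ — helper file for `stub_slabNonconcentration` (stub NC)
of line `swap-odd-threshold-rigidity` (crux `EmbeddedDrudeMourre.MourreDissolution`, item
stmt-AtomisticToContinuum-12594; helper file, `--supports`)

On the exchange slab `{|sin((k₃−k₁)/2)| < η}` write `k₃ − k₁ = x + 2πn` with `|x| ≤ π|sin((k₃−k₁)/2)|`.
* Region T₁ (`k₂` at distance `≥ ρ₁` from `±κ*`, three intervals of the cell): the `k₂`-fibre map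
  `k₂ ↦ Ω(k₁,k₂,k₃)` has derivative `v(k₂) − v(k₂ − x)`, of fixed sign and modulus `≥ c|x|` on each piece
  (mean-value inequality for `v` with the floor `|v′| ≥ c` away from `±κ*`), so each weighted fibre
  integral is `≤ Cw sin²((k₃−k₁)/2)·2r/(c|x|) ≤ Cw η r/c`; integrating over `(k₁,k₃) ∈ cell²` gives
  `≤ (2π)²·3·Cw η r/c`.
(Region T₂ is the companion file `…SlabRegionT2`.)
No cited facts.
-/

noncomputable section

namespace Summit.AtomisticToContinuum.FouriersLaw.Theorems.MourreDissolution

open Real Set MeasureTheory Filter Topology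
open scoped ENNReal
open Literature.MathematicalPhysics.KineticTheory.PhononBoltzmann

/-! ### One monotone piece of a `k₂`-fibre -/

/-- **Piece lemma.** On a convex measurable piece `P` of a `k₂`-fibre (`k₁, k₃` fixed,
`k₃ − k₁ = x + 2πn`, `x ≠ 0`) such that `k₂, k₂ − x ∈ D` for `k₂ ∈ P`, where `v′ ≥ c` on `D` or
`v′ ≤ −c` on `D` (`c > 0`, `D` convex), the fibre map `k₂ ↦ Ω(k₁,k₂,k₃)` is `c|x|`-expanding on `P`, so
`∫_P 1{Ω ∈ (E−r,E+r)}·w ≤ B·2r/(c|x|)` whenever `w ≤ B` on `P`. [folklore] -/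
theorem slabRegion_piece {ω₂ : ℝ} (hω : 0 < ω₂) {k₁ k₃ x : ℝ} {n : ℤ}
    (hx : k₃ - k₁ = x + n * (2 * π)) (hx0 : x ≠ 0) {P D : Set ℝ} (hP : Convex ℝ P)
    (hPm : MeasurableSet P) (hD : Convex ℝ D) (hsub : ∀ k₂ ∈ P, k₂ ∈ D ∧ k₂ - x ∈ D) {c : ℝ} (hc : 0 < c)
    (hsign : (∀ t ∈ interior D, c ≤ deriv (groupVelocity ω₂) t) ∨
      (∀ t ∈ interior D, deriv (groupVelocity ω₂) t ≤ -c))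
    {w : ℝ → ℝ≥0∞} {B : ℝ≥0∞} (hw : ∀ k₂ ∈ P, w k₂ ≤ B) (E r : ℝ) :
    ∫⁻ k₂ in P, (Ioo (E - r) (E + r)).indicator 1 (resonanceFn ω₂ k₁ k₂ k₃) * w k₂ ≤
      B * ENNReal.ofReal (2 * r / (c * |x|)) := by
  set v := groupVelocity ω₂ with hv
  set g : ℝ → ℝ := fun k₂ => resonanceFn ω₂ k₁ k₂ k₃ with hg
  set g' : ℝ → ℝ := fun k₂ => v k₂ - v (k₂ - x) with hg'
  -- the fibre derivative, with the fourth momentum reduced by periodicity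
  have hder : ∀ k₂, HasDerivAt g (g' k₂) k₂ := by
    intro k₂
    have h := slabFibre_hasDerivAt_k2 hω k₁ k₂ k₃
    have hk : k₁ + k₂ - k₃ = k₂ - x - n * (2 * π) := by linarith
    have hred : groupVelocity ω₂ (k₁ + k₂ - k₃) = v (k₂ - x) := by
      rw [hk]; exact (groupVelocity_periodic ω₂).sub_int_mul_eq n
    rw [hred] at h
    exact h
  -- mean-value inequalities for `v` on `D`
  have hvc : ContinuousOn v D := (velShape_continuous ω₂ hω).continuousOn
  have hvd : DifferentiableOn ℝ v (interior D) := fun t _ =>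
    (hasDerivAt_groupVelocity hω t).differentiableAt.differentiableWithinAt
  have hm : 0 < c * |x| := mul_pos hc (abs_pos.2 hx0)
  -- expansion of `g` on `P` with constant `c|x|`
  have hexp : ∀ s ∈ P, ∀ t ∈ P, c * |x| * |t - s| ≤ |g t - g s| := by
    rcases hsign with hinc | hdec
    · have key := hD.mul_sub_le_image_sub_of_le_deriv hvc hvd hinc
      rcases le_or_gt 0 x with hx1 | hx1
      · refine slabFibre_expand_of_deriv_ge hP (fun k₂ _ => hder k₂) (fun k₂ hk₂ => ?_)
        have h := key (k₂ - x) (hsub k₂ hk₂).2 k₂ (hsub k₂ hk₂).1 (by linarith)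
        rw [abs_of_nonneg hx1]
        simp only [hg']
        linarith
      · refine slabFibre_expand_of_deriv_le hP (fun k₂ _ => hder k₂) (fun k₂ hk₂ => ?_)
        have h := key k₂ (hsub k₂ hk₂).1 (k₂ - x) (hsub k₂ hk₂).2 (by linarith)
        rw [abs_of_neg hx1]
        simp only [hg']
        linarith
    · have key := hD.image_sub_le_mul_sub_of_deriv_le hvc hvd hdec
      rcases le_or_gt 0 x with hx1 | hx1
      · refine slabFibre_expand_of_deriv_le hP (fun k₂ _ => hder k₂) (fun k₂ hk₂ => ?_)
        have h := key (k₂ - x) (hsub k₂ hk₂).2 k₂ (hsub k₂ hk₂).1 (by linarith)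
        rw [abs_of_nonneg hx1]
        simp only [hg']
        linarith
      · refine slabFibre_expand_of_deriv_ge hP (fun k₂ _ => hder k₂) (fun k₂ hk₂ => ?_)
        have h := key k₂ (hsub k₂ hk₂).1 (k₂ - x) (hsub k₂ hk₂).2 (by linarith)
        rw [abs_of_neg hx1]
        simp only [hg']
        linarith
  exact slabFibre_weighted_le hPm hm hexp hw E r

/-! ### Region T₁: the `k₂`-fibres away from `±κ*` -/

/-- **T₁ fibre bound.** For `(k₁, k₃)` on the slab (`|sin((k₃−k₁)/2)| < η`, `πη ≤ ρ₁/2`,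
`ρ₁ ≤ π − κ*`) and a weight `w ≤ Cw·sin²((k₃−k₁)/2)`, the weighted sublevel integral over the three far
pieces of the `k₂`-cell is `≤ 3·Cw·r·η/c`, `c` a floor of `|v′|` at distance `≥ ρ₁/2` from `±κ*`. [folklore] -/
theorem slabRegion_T1_fibre {ω₂ : ℝ} (hω : 0 < ω₂) {ρ₁ c η Cw : ℝ} (hc : 0 < c) (hη : 0 < η)
    (hηρ : π * η ≤ ρ₁ / 2) (hρκ : ρ₁ ≤ π - kappaStar ω₂) (hCw : 0 ≤ Cw)
    (hinc : ∀ t ∈ Icc (-kappaStar ω₂ + ρ₁ / 2) (kappaStar ω₂ - ρ₁ / 2), c ≤ deriv (groupVelocity ω₂) t)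
    (hdec : ∀ t ∈ Icc (kappaStar ω₂ + ρ₁ / 2) (2 * π - kappaStar ω₂ - ρ₁ / 2),
      deriv (groupVelocity ω₂) t ≤ -c)
    {k₁ k₃ : ℝ} (hS : |Real.sin ((k₃ - k₁) / 2)| < η) {w : ℝ → ℝ≥0∞}
    (hw : ∀ k₂, w k₂ ≤ ENNReal.ofReal (Cw * Real.sin ((k₃ - k₁) / 2) ^ 2)) {r : ℝ} (hr : 0 ≤ r) (E : ℝ) :
    ∫⁻ k₂ in Icc (-π) (-kappaStar ω₂ - ρ₁) ∪ Icc (-kappaStar ω₂ + ρ₁) (kappaStar ω₂ - ρ₁) ∪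
        Icc (kappaStar ω₂ + ρ₁) π,
      (Ioo (E - r) (E + r)).indicator 1 (resonanceFn ω₂ k₁ k₂ k₃) * w k₂ ≤
      ENNReal.ofReal (3 * (Cw * r * η / c)) := by
  set κ := kappaStar ω₂ with hκdef
  set S₁ := Real.sin ((k₃ - k₁) / 2) with hS₁
  -- degenerate fibre: on the exchange plane the weight vanishes
  by_cases hS0 : S₁ = 0
  · have hw0 : ∀ k₂, w k₂ = 0 := fun k₂ => by
      have := hw k₂; rw [hS0] at this; simpa using this
    simp only [hw0, mul_zero, lintegral_zero]
    exact bot_le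
  -- periodic reduction of `k₃ − k₁`
  obtain ⟨n, x, hx, hxπ, hxS, hSx⟩ := slabFibre_reduce (k₃ - k₁)
  have hS1pos : 0 < |S₁| := abs_pos.2 hS0
  have hx0 : x ≠ 0 := by
    intro h; rw [h, abs_zero] at hSx; linarith
  have hxρ : |x| ≤ ρ₁ / 2 := by
    have : |x| ≤ π * η := hxS.trans (by nlinarith [pi_pos, hS.le])
    linarith
  have hxabs := abs_le.1 hxρ
  -- the bound on each piece
  have hB : ENNReal.ofReal (Cw * S₁ ^ 2) * ENNReal.ofReal (2 * r / (c * |x|)) ≤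
      ENNReal.ofReal (Cw * r * η / c) := by
    rw [← ENNReal.ofReal_mul (by positivity)]
    apply ENNReal.ofReal_le_ofReal
    have hcx : 0 < c * |x| := mul_pos hc (abs_pos.2 hx0)
    rw [show Cw * S₁ ^ 2 * (2 * r / (c * |x|)) = (Cw * r / c) * (S₁ ^ 2 * 2 / |x|) by
      field_simp, show Cw * r * η / c = (Cw * r / c) * η by ring]
    apply mul_le_mul_of_nonneg_left _ (by positivity)
    rw [div_le_iff₀ (abs_pos.2 hx0), show S₁ ^ 2 = |S₁| ^ 2 from (sq_abs _).symm]
    nlinarith [hS.le, hSx, abs_nonneg S₁]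
  have piece : ∀ {P D : Set ℝ}, Convex ℝ P → MeasurableSet P → Convex ℝ D →
      (∀ k₂ ∈ P, k₂ ∈ D ∧ k₂ - x ∈ D) →
      ((∀ t ∈ interior D, c ≤ deriv (groupVelocity ω₂) t) ∨
        (∀ t ∈ interior D, deriv (groupVelocity ω₂) t ≤ -c)) →
      ∫⁻ k₂ in P, (Ioo (E - r) (E + r)).indicator 1 (resonanceFn ω₂ k₁ k₂ k₃) * w k₂ ≤
        ENNReal.ofReal (Cw * r * η / c) := fun hP hPm hD hsub hsign =>
    (slabRegion_piece hω hx hx0 hP hPm hD hsub hc hsign (fun k₂ _ => hw k₂) E r).trans hB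
  -- the three pieces
  have h2 := piece (P := Icc (-κ + ρ₁) (κ - ρ₁)) (D := Icc (-κ + ρ₁ / 2) (κ - ρ₁ / 2))
    (convex_Icc _ _) measurableSet_Icc (convex_Icc _ _)
    (fun k₂ hk₂ => ⟨⟨by linarith [hk₂.1], by linarith [hk₂.2]⟩,
      ⟨by linarith [hk₂.1], by linarith [hk₂.2]⟩⟩)
    (Or.inl fun t ht => hinc t (interior_subset ht))
  have h3 := piece (P := Icc (κ + ρ₁) π) (D := Icc (κ + ρ₁ / 2) (2 * π - κ - ρ₁ / 2))
    (convex_Icc _ _) measurableSet_Icc (convex_Icc _ _)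
    (fun k₂ hk₂ => ⟨⟨by linarith [hk₂.1], by linarith [hk₂.2]⟩,
      ⟨by linarith [hk₂.1], by linarith [hk₂.2]⟩⟩)
    (Or.inr fun t ht => hdec t (interior_subset ht))
  have h1 := piece (P := Icc (-π) (-κ - ρ₁)) (D := Icc (-π - ρ₁ / 2) (-κ - ρ₁ / 2))
    (convex_Icc _ _) measurableSet_Icc (convex_Icc _ _)
    (fun k₂ hk₂ => ⟨⟨by linarith [hk₂.1], by linarith [hk₂.2]⟩,
      ⟨by linarith [hk₂.1], by linarith [hk₂.2]⟩⟩)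
    (Or.inr fun t ht => by
      have ht' := interior_subset ht
      rw [← (velShape_deriv_periodic ω₂) t]
      exact hdec (t + 2 * π) ⟨by linarith [ht'.1], by linarith [ht'.2]⟩)
  calc _ ≤ (∫⁻ k₂ in Icc (-π) (-κ - ρ₁) ∪ Icc (-κ + ρ₁) (κ - ρ₁),
            (Ioo (E - r) (E + r)).indicator 1 (resonanceFn ω₂ k₁ k₂ k₃) * w k₂) +
          ∫⁻ k₂ in Icc (κ + ρ₁) π, (Ioo (E - r) (E + r)).indicator 1 (resonanceFn ω₂ k₁ k₂ k₃) * w k₂ :=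
        lintegral_union_le _ _ _
    _ ≤ ((∫⁻ k₂ in Icc (-π) (-κ - ρ₁), (Ioo (E - r) (E + r)).indicator 1 (resonanceFn ω₂ k₁ k₂ k₃) * w k₂) +
          ∫⁻ k₂ in Icc (-κ + ρ₁) (κ - ρ₁), (Ioo (E - r) (E + r)).indicator 1 (resonanceFn ω₂ k₁ k₂ k₃) * w k₂) +
          ∫⁻ k₂ in Icc (κ + ρ₁) π, (Ioo (E - r) (E + r)).indicator 1 (resonanceFn ω₂ k₁ k₂ k₃) * w k₂ := by
        gcongr; exact lintegral_union_le _ _ _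
    _ ≤ ENNReal.ofReal (Cw * r * η / c) + ENNReal.ofReal (Cw * r * η / c) + ENNReal.ofReal (Cw * r * η / c) := by
        gcongr
    _ = ENNReal.ofReal (3 * (Cw * r * η / c)) := by
        rw [← ENNReal.ofReal_add (by positivity) (by positivity),
          ← ENNReal.ofReal_add (by positivity) (by positivity)]
        congr 1; ring


/-- The resonance function read at `p = (k₁,(k₃,k₂))` is continuous. [folklore] -/
theorem slabRegion_continuous_resonanceFn (ω₂ : ℝ) :
    Continuous fun p : ℝ × ℝ × ℝ => resonanceFn ω₂ p.1 p.2.2 p.2.1 := by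
  unfold resonanceFn dispersion; fun_prop

/-- The sublevel indicator `p ↦ 1{Ω(p) ∈ (E−r, E+r)}·w(p)` is measurable for measurable `w`. [folklore] -/
theorem slabRegion_measurable_F {ω₂ : ℝ} {w : ℝ × ℝ × ℝ → ℝ≥0∞} (hwm : Measurable w) (E r : ℝ) :
    Measurable fun p : ℝ × ℝ × ℝ =>
      (Ioo (E - r) (E + r)).indicator 1 (resonanceFn ω₂ p.1 p.2.2 p.2.1) * w p :=
  ((measurable_one.indicator measurableSet_Ioo).comp
    (slabRegion_continuous_resonanceFn ω₂).measurable).mul hwm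

/-- The slab `{|sin((k₃−k₁)/2)| < η}` is measurable. [folklore] -/
theorem slabRegion_measurableSet_slab (η : ℝ) :
    MeasurableSet {p : ℝ × ℝ × ℝ | |Real.sin ((p.2.1 - p.1) / 2)| < η} :=
  (isOpen_lt (by fun_prop) continuous_const).measurableSet

/-- **Region T₁.** The weighted sublevel mass of the part of the slab `{|sin((k₃−k₁)/2)| < η}` of the
cell where `k₂` is `ρ₁`-far from `±κ*` is `≤ (2π)²·3·Cw·r·η/c`. [folklore] -/
theorem slabRegion_T1 {ω₂ : ℝ} (hω : 0 < ω₂) {ρ₁ c η Cw : ℝ} (hc : 0 < c) (hη : 0 < η)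
    (hηρ : π * η ≤ ρ₁ / 2) (hρκ : ρ₁ ≤ π - kappaStar ω₂) (hCw : 0 ≤ Cw)
    (hinc : ∀ t ∈ Icc (-kappaStar ω₂ + ρ₁ / 2) (kappaStar ω₂ - ρ₁ / 2), c ≤ deriv (groupVelocity ω₂) t)
    (hdec : ∀ t ∈ Icc (kappaStar ω₂ + ρ₁ / 2) (2 * π - kappaStar ω₂ - ρ₁ / 2),
      deriv (groupVelocity ω₂) t ≤ -c)
    {w : ℝ × ℝ × ℝ → ℝ≥0∞}
    (hw : ∀ p, w p ≤ ENNReal.ofReal (Cw * Real.sin ((p.2.1 - p.1) / 2) ^ 2)) {r : ℝ} (hr : 0 ≤ r) (E : ℝ) :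
    ∫⁻ p in (Ioc (-π) π ×ˢ (Ioc (-π) π ×ˢ Ioc (-π) π)) ∩ {p | |Real.sin ((p.2.1 - p.1) / 2)| < η} ∩
        {p | p.2.2 ∈ Icc (-π) (-kappaStar ω₂ - ρ₁) ∪ Icc (-kappaStar ω₂ + ρ₁) (kappaStar ω₂ - ρ₁) ∪
          Icc (kappaStar ω₂ + ρ₁) π},
      (Ioo (E - r) (E + r)).indicator 1 (resonanceFn ω₂ p.1 p.2.2 p.2.1) * w p ≤
      ENNReal.ofReal ((2 * π) ^ 2 * (3 * (Cw * r * η / c))) := by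
  set κ := kappaStar ω₂ with hκdef
  set I : Set ℝ := Ioc (-π) π with hI
  set far : Set ℝ := Icc (-π) (-κ - ρ₁) ∪ Icc (-κ + ρ₁) (κ - ρ₁) ∪ Icc (κ + ρ₁) π with hfar
  set F : ℝ × ℝ × ℝ → ℝ≥0∞ := fun p =>
    (Ioo (E - r) (E + r)).indicator 1 (resonanceFn ω₂ p.1 p.2.2 p.2.1) * w p with hF
  set S : Set (ℝ × ℝ × ℝ) := (I ×ˢ (I ×ˢ I)) ∩ {p | |Real.sin ((p.2.1 - p.1) / 2)| < η} ∩
    {p | p.2.2 ∈ far} with hS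
  have hfarm : MeasurableSet far :=
    (measurableSet_Icc.union measurableSet_Icc).union measurableSet_Icc
  have hSm : MeasurableSet S :=
    ((measurableSet_Ioc.prod (measurableSet_Ioc.prod measurableSet_Ioc)).inter
      (slabRegion_measurableSet_slab η)).inter (measurable_snd.snd hfarm)
  set B : ℝ≥0∞ := ENNReal.ofReal (3 * (Cw * r * η / c)) with hB
  -- the fibre bound, pointwise in `(k₁, k₃)`
  have hfib : ∀ k₁ k₃, ∫⁻ k₂, S.indicator F (k₁, (k₃, k₂)) ≤ I.indicator 1 k₁ * (I.indicator 1 k₃ * B) := by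
    intro k₁ k₃
    by_cases hk₁ : k₁ ∈ I
    · by_cases hk₃ : k₃ ∈ I
      · simp only [indicator_of_mem hk₁, indicator_of_mem hk₃, Pi.one_apply, one_mul]
        by_cases hsl : |Real.sin ((k₃ - k₁) / 2)| < η
        · have hpt : ∀ k₂, S.indicator F (k₁, (k₃, k₂)) ≤ far.indicator (fun k₂ => F (k₁, (k₃, k₂))) k₂ := by
            intro k₂
            by_cases hp : (k₁, (k₃, k₂)) ∈ S
            · rw [indicator_of_mem hp, indicator_of_mem (show k₂ ∈ far from hp.2)]
            · rw [indicator_of_notMem hp]; exact bot_le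
          calc ∫⁻ k₂, S.indicator F (k₁, (k₃, k₂)) ≤ ∫⁻ k₂, far.indicator (fun k₂ => F (k₁, (k₃, k₂))) k₂ :=
                lintegral_mono hpt
            _ = ∫⁻ k₂ in far, F (k₁, (k₃, k₂)) := lintegral_indicator hfarm _
            _ ≤ B := slabRegion_T1_fibre hω hc hη hηρ hρκ hCw hinc hdec hsl
                (w := fun k₂ => w (k₁, (k₃, k₂))) (fun k₂ => hw (k₁, (k₃, k₂))) hr E
        · have h0 : ∀ k₂, S.indicator F (k₁, (k₃, k₂)) = 0 := fun k₂ =>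
            indicator_of_notMem (fun hp => hsl hp.1.2) _
          simp only [h0, lintegral_zero]; exact bot_le
      · have h0 : ∀ k₂, S.indicator F (k₁, (k₃, k₂)) = 0 := fun k₂ =>
          indicator_of_notMem (fun hp => hk₃ hp.1.1.2.1) _
        simp only [h0, lintegral_zero]; exact bot_le
    · have h0 : ∀ k₂, S.indicator F (k₁, (k₃, k₂)) = 0 := fun k₂ =>
        indicator_of_notMem (fun hp => hk₁ hp.1.1.1) _
      simp only [h0, lintegral_zero]; exact bot_le
  have hIvol : volume I = ENNReal.ofReal (2 * π) := by
    rw [hI, Real.volume_Ioc]; congr 1; ring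
  have hmI : Measurable (I.indicator (1 : ℝ → ℝ≥0∞)) := measurable_one.indicator measurableSet_Ioc
  calc ∫⁻ p in S, F p = ∫⁻ p, S.indicator F p := (lintegral_indicator hSm F).symm
    _ ≤ ∫⁻ k₁, ∫⁻ q, S.indicator F (k₁, q) := by
        rw [Measure.volume_eq_prod]; exact lintegral_prod_le _
    _ ≤ ∫⁻ k₁, ∫⁻ k₃, ∫⁻ k₂, S.indicator F (k₁, (k₃, k₂)) :=
        lintegral_mono fun k₁ => by rw [Measure.volume_eq_prod]; exact lintegral_prod_le _
    _ ≤ ∫⁻ k₁, ∫⁻ k₃, I.indicator 1 k₁ * (I.indicator 1 k₃ * B) :=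
        lintegral_mono fun k₁ => lintegral_mono fun k₃ => hfib k₁ k₃
    _ = ENNReal.ofReal (2 * π) * (ENNReal.ofReal (2 * π) * B) := by
        have hinner : ∀ k₁, ∫⁻ k₃, I.indicator 1 k₁ * (I.indicator 1 k₃ * B) =
            I.indicator 1 k₁ * (ENNReal.ofReal (2 * π) * B) := fun k₁ => by
          rw [lintegral_const_mul _ (hmI.mul_const B), lintegral_mul_const B hmI,
            lintegral_indicator_one measurableSet_Ioc, hIvol]
        rw [lintegral_congr hinner, lintegral_mul_const _ hmI, lintegral_indicator_one measurableSet_Ioc,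
          hIvol]
    _ = ENNReal.ofReal ((2 * π) ^ 2 * (3 * (Cw * r * η / c))) := by
        rw [hB, ← ENNReal.ofReal_mul (by positivity), ← ENNReal.ofReal_mul (by positivity)]
        congr 1; ring

end Summit.AtomisticToContinuum.FouriersLaw.Theorems.MourreDissolution
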